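import Literature.NumberTheory.LFunctions.RayClassLFunctionRealZeros
import Literature.NumberTheory.LFunctions.DedekindZetaRealZerosUniform
import HarnessLib

/-!
# Landau–Page for `ζ_K` against the Hecke `L`-function of a ray class character `mod 𝔪`, uniformly in the field and
# the modulus (Thorner–Zaman 2019 Theorem 3.1, the pair `(1, ψ)`)

Topic `Literature/NumberTheory/LFunctions`, namespace `Literature.NumberTheory.LFunctions`.
Everything here is PROVED (theorems only; no named facts).

The ray-class counterpart of `DedekindZetaRealZerosUniform.exists_landau_dedekindZeta₁_classGroupLFunction₀`:
* `exists_landau_dedekindZeta₁_rayClass (n)` — for every `n` there is `c = c(n) > 0` such that for every `K` with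
  `n_K ≤ n`, every `𝔪 ≠ 0`, every ray class character `ψ mod 𝔪` non-principal on the primes `∤ 𝔪` with primitive data `D`,
  every real zero `β₀` of `ζ₁_K = (s−1)ζ_K` and every real zero `β` of `L(·, χ₀)`:
  `min(β₀, β) ≤ 1 − c/(log(|d_K| N𝔪) + log 4)`.
MV (11.4) `0 ≤ L(Λ_K, σ) + Re L(Λ_ψ, σ)` with `L(Λ_K, σ) ≤ 1/(σ−1) − 1/(σ−β₀) + K'ℒ₀` (partial fraction of `ζ₁_K`) and
`Re L(Λ_ψ, σ) ≤ Eℒ₀ − 1/(σ−β)` (MV (11.2), from the uniform datum of `L_𝔪(·, ψ)`) at `σ = 1 + 2(1 − min)`.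

## References
* [ThornerZaman2019] J. Thorner, A. Zaman, Algebra & Number Theory 13 (2019), Theorem 3.1.
* [MontgomeryVaughan2007] H. L. Montgomery, R. C. Vaughan, *Multiplicative Number Theory I*, Theorem 11.7.
-/

noncomputable section

open scoped NumberField nonZeroDivisors
open Complex Filter Topology Set Metric NumberField IsDedekindDomain Finset

namespace Literature.NumberTheory.LFunctions

open Literature.NumberTheory.LFunctions.NumberField
open scoped Classical

/-- **Landau–Page for `ζ_K` against `L(s, χ₀)` of a ray class character `mod 𝔪`, uniformly in the field and the modulus**
(MV Theorem 11.7 for the pair `(1, ψ)`; part of [ThornerZaman2019, Theorem 3.1]). [cite: MontgomeryVaughan2007, Theorem 11.7] -/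
theorem exists_landau_dedekindZeta₁_rayClass (n : ℕ) :
    ∃ c : ℝ, 0 < c ∧ ∀ (K : Type*) [Field K] [NumberField K], Module.finrank ℚ K ≤ n →
      ∀ (𝔪 : Ideal (𝓞 K)) (ψ : HeightOneSpectrum (𝓞 K) → ℂ), IsRayClassCharacter 𝔪 ψ →
      (∃ v : HeightOneSpectrum (𝓞 K), ¬ 𝔪 ≤ v.asIdeal ∧ ψ v ≠ 1) →
      ∀ (D : RayClassPrimitiveData 𝔪 ψ) (β₀ β : ℝ), dedekindZeta₁ K β₀ = 0 → D.L β = 0 →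
        min β₀ β ≤ 1 - c / (Real.log (((discr K).natAbs : ℝ) * ((Ideal.absNorm 𝔪 : ℕ) : ℝ)) + Real.log 4) := by
  -- the constant for degree `m`, antitone in `m`
  set cof : ℕ → ℝ := fun m ↦
    min (3 * (1 : ℝ) / 64) (1 / (6 * (77760 * (5 * (m : ℝ) + 2) +
      8 * (2 * ((m : ℝ) + 2) + |Real.log ((Real.exp (2 * m) * (3 / 2) ^ m) / ((32 * Real.exp (-(32 * m))) * ((1 : ℝ) / 32)))| + 1) /
        ((1 : ℝ) / 4) + 1))) with hcof
  have hcof_pos : ∀ m, 0 < cof m := fun m ↦ by rw [hcof]; exact lt_min (by norm_num) (by positivity)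
  have hlog : ∀ m : ℕ, Real.log ((Real.exp (2 * m) * (3 / 2) ^ m) / ((32 * Real.exp (-(32 * m))) * ((1 : ℝ) / 32))) =
      (34 + Real.log (3 / 2)) * m := by
    intro m
    rw [show (32 * Real.exp (-(32 * (m : ℝ)))) * ((1 : ℝ) / 32) = Real.exp (-(32 * m)) by ring,
      Real.log_div (by positivity) (Real.exp_pos _).ne', Real.log_mul (Real.exp_pos _).ne' (by positivity), Real.log_exp,
      Real.log_exp, Real.log_pow]
    ring
  have hcof_anti : ∀ m m' : ℕ, m ≤ m' → cof m' ≤ cof m := by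
    intro m m' hmm
    have hmm' : (m : ℝ) ≤ m' := by exact_mod_cast hmm
    have hl32 : 0 ≤ Real.log (3 / 2 : ℝ) := Real.log_nonneg (by norm_num)
    rw [hcof]; dsimp only
    rw [hlog m, hlog m', abs_of_nonneg (by positivity), abs_of_nonneg (by positivity)]
    refine min_le_min le_rfl (one_div_le_one_div_of_le (by positivity) ?_)
    have : (34 + Real.log (3 / 2)) * (m : ℝ) ≤ (34 + Real.log (3 / 2)) * m' := mul_le_mul_of_nonneg_left hmm' (by positivity)
    nlinarith
  refine ⟨cof n, hcof_pos n, fun K _ _ hnK 𝔪 ψ hψ hnt D β₀ β hz₀ hz ↦ ?_⟩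
  -- reduce to the constant for the degree of `K`
  set nK : ℕ := Module.finrank ℚ K with hnKdef
  have h𝔪 := D.modulus_ne_bot
  have hQ1 := one_le_discr_mul_absNorm K h𝔪
  set ℒ₀ : ℝ := Real.log (((discr K).natAbs : ℝ) * ((Ideal.absNorm 𝔪 : ℕ) : ℝ)) + Real.log 4 with hℒ₀
  have hℒ₀1 : 1 ≤ ℒ₀ := UniformTwistedZFRData.log_add_log_four_ge hQ1
  have hℒ₀0 : 0 < ℒ₀ := by linarith
  suffices key : min β₀ β ≤ 1 - cof nK / ℒ₀ by
    refine key.trans ?_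
    have := hcof_anti _ _ hnK
    gcongr
  -- the parameters of the datum for degree `nK`
  set A : ℝ := (nK : ℝ) + 2 with hAdef
  set Cg : ℝ := Real.exp (2 * nK) * (3 / 2) ^ nK with hCg
  set c₁ : ℝ := 32 * Real.exp (-(32 * nK)) with hc₁
  set Kc : ℝ := 77760 * (5 * nK + 2) with hKc
  set E : ℝ := 8 * (2 * A + |Real.log (Cg / (c₁ * ((1 : ℝ) / 32)))| + 1) / ((1 : ℝ) / 4) with hE
  have hE0 : 0 ≤ E := by rw [hE]; positivity
  have hKc0 : 0 ≤ Kc := by positivity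
  set c : ℝ := min (3 * (1 : ℝ) / 64) (1 / (6 * (Kc + E + 1))) with hcdef
  have hcof_eq : cof nK = c := by rw [hcof, hcdef, hKc, hE, hAdef, hCg, hc₁]
  rw [hcof_eq]
  have hc : 0 < c := lt_min (by norm_num) (by positivity)
  have hcη : c ≤ 3 / 64 := by have := min_le_left (3 * (1 : ℝ) / 64) (1 / (6 * (Kc + E + 1))); linarith
  have hcK : c ≤ 1 / (6 * (Kc + E + 1)) := min_le_right _ _
  have hcℒ : c / ℒ₀ ≤ c := div_le_self hc.le hℒ₀1
  have hβ₀1 : β₀ < 1 := realZero_dedekindZeta₁_lt_one hz₀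
  have hz' : D.LMod β = 0 := by rw [RayClassPrimitiveData.LMod, hz, zero_mul]
  have hβ1 : β < 1 := D.realZero_lt_one hnt hz'
  set u : ℝ := 1 - min β₀ β with hu
  have hu0 : 0 < u := by
    rw [hu]; have := min_le_left β₀ β; linarith
  by_contra hcon
  rw [not_le] at hcon
  have hularge : u < c / ℒ₀ := by rw [hu]; linarith
  have husmall : u < 3 / 64 := by linarith
  have hβ₀u : 1 - β₀ ≤ u := by rw [hu]; have := min_le_left β₀ β; linarith
  have hβu : 1 - β ≤ u := by rw [hu]; have := min_le_right β₀ β; linarith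
  set σ : ℝ := 1 + 2 * u with hσdef
  have hσ1 : 1 < σ := by rw [hσdef]; linarith
  have hσ2 : σ ≤ 2 := by rw [hσdef]; linarith
  set d : ℝ := 2 * u with hddef
  have hdpos : 0 < d := by positivity
  have hd1 : d ≤ 3 * (1 : ℝ) / 32 := by rw [hddef]; linarith
  have hσd : σ = 1 + d := by rw [hσdef, hddef]
  -- (1) `L(Λ_K, σ) ≤ 1/(σ−1) − 1/(σ−β₀) + K'ℒ₀`
  have hord₀ : ((1 : ℕ) : ℕ∞) ≤ analyticOrderAt (dedekindZeta₁ K) β₀ := by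
    have hne0 : analyticOrderAt (dedekindZeta₁ K) β₀ ≠ 0 := by
      rw [ne_eq, ((dedekindZeta₁_differentiable K).analyticAt _).analyticOrderAt_eq_zero, not_not]
      exact hz₀
    exact Order.one_le_iff_ne_zero.mpr hne0
  have hT : ∀ b ∈ ({β₀} : Finset ℝ), 1 / 16 ≤ b ∧ b < 1 ∧
      (((fun _ ↦ 1 : ℝ → ℕ) b : ℕ) : ℕ∞) ≤ analyticOrderAt (dedekindZeta₁ K) b := by
    intro b hb
    rw [Finset.mem_singleton] at hb
    subst hb
    exact ⟨by linarith, hβ₀1, hord₀⟩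
  have hA := re_LSeries_vonMangoldtNorm_ofReal_le_of_realZeros {β₀} (fun _ ↦ 1) hT hσ1 hσ2
  rw [Finset.sum_singleton] at hA
  simp only [Nat.cast_one] at hA
  have hM : 77760 * discBound K 0 ≤ Kc * ℒ₀ := by
    have h1 := discBound_zero_le' (K := K)
    have hd : (0 : ℝ) < ((discr K).natAbs : ℝ) := by exact_mod_cast Int.natAbs_pos.mpr (discr_ne_zero K)
    have hm : (1 : ℝ) ≤ ((Ideal.absNorm 𝔪 : ℕ) : ℝ) := by
      exact_mod_cast Nat.one_le_iff_ne_zero.mpr (by rw [Ne, Ideal.absNorm_eq_zero_iff]; exact h𝔪)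
    have h2 : Real.log ((discr K).natAbs : ℝ) ≤ Real.log (((discr K).natAbs : ℝ) * ((Ideal.absNorm 𝔪 : ℕ) : ℝ)) :=
      Real.log_le_log hd (by nlinarith)
    have h3 : Real.log ((discr K).natAbs : ℝ) + Real.log 4 ≤ ℒ₀ := by rw [hℒ₀]; linarith
    calc 77760 * discBound K 0 ≤ 77760 * (5 * Module.finrank ℚ K + 2) * (Real.log ((discr K).natAbs : ℝ) + Real.log 4) := h1
      _ ≤ Kc * ℒ₀ := by rw [hKc, hnKdef]; exact mul_le_mul_of_nonneg_left h3 (by positivity)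
  -- (2) `Re L(Λ_ψ, σ) ≤ Eℒ₀ − 1/(σ−β)` from the uniform datum of `ψ`
  have hB : (LSeries (twistVonMangoldt K (rayClassCoeffHom 𝔪 ψ)) (((1 + d : ℝ) : ℂ))).re ≤
      E * ℒ₀ - 1 / (1 + d - β) := by
    have hb : 1 - 7 * (1 : ℝ) / 32 ≤ β := by linarith
    by_cases h2 : ∀ v : HeightOneSpectrum (𝓞 K), ¬ 𝔪 ≤ v.asIdeal → ψ v ^ 2 = 1
    · have hdat := D.uniformTwistedZFRData_of_eq hnt h2
      have hpack := hdat.exists_package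
      exact hdat.re_LSeries₁_ofReal_le_of_realZero hpack hz' hb hdpos hd1
    · push Not at h2
      have hdat := D.uniformTwistedZFRData_of_ne hψ hnt h2
      have hpack := hdat.exists_package
      exact hdat.re_LSeries₁_ofReal_le_of_realZero hpack hz' hb hdpos hd1
  rw [← hσd] at hB
  -- (3) MV (11.4)
  have h114 := TwistedZFR.re_add_re_nonneg (norm_twistVonMangoldt_le (norm_rayClassCoeffHom_le h𝔪 D.norm_psi_le_one))
    (fun s hs ↦ LSeriesSummable_vonMangoldtNorm hs) hσ1
  have e₀ : 1 / (3 * u) ≤ 1 / (σ - β₀) :=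
    div_le_div_of_nonneg_left zero_le_one (by linarith) (by rw [hσdef]; linarith)
  have e₁ : 1 / (3 * u) ≤ 1 / (σ - β) :=
    div_le_div_of_nonneg_left zero_le_one (by linarith) (by rw [hσdef]; linarith)
  have hkey : 2 / (3 * u) - 1 / (σ - 1) ≤ (Kc + E) * ℒ₀ := by
    have e : 2 / (3 * u) = 1 / (3 * u) + 1 / (3 * u) := by ring
    rw [e]
    linarith
  have hval : 2 / (3 * u) - 1 / (σ - 1) = 1 / (6 * u) := by
    have e2 : σ - 1 = 2 * u := by rw [hσdef]; ring
    have hu' : u ≠ 0 := hu0.ne'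
    rw [e2]; field_simp; norm_num
  rw [hval] at hkey
  have hKE : 0 < 6 * (Kc + E + 1) := by positivity
  have hc' : c * (6 * (Kc + E + 1)) ≤ 1 := by
    rw [le_div_iff₀ hKE] at hcK; exact hcK
  have h6 : 1 ≤ 6 * u * ((Kc + E) * ℒ₀) := by
    rw [div_le_iff₀ (by positivity)] at hkey; linarith
  have h7 : 6 * u * ((Kc + E) * ℒ₀) ≤ (u * ℒ₀) * (6 * (Kc + E + 1)) := by
    have : (Kc + E) * ℒ₀ ≤ (Kc + E + 1) * ℒ₀ := mul_le_mul_of_nonneg_right (by linarith) hℒ₀0.le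
    calc 6 * u * ((Kc + E) * ℒ₀) ≤ 6 * u * ((Kc + E + 1) * ℒ₀) := mul_le_mul_of_nonneg_left this (by positivity)
      _ = (u * ℒ₀) * (6 * (Kc + E + 1)) := by ring
  have hfinal : c / ℒ₀ ≤ u := by
    rw [div_le_iff₀ hℒ₀0]
    exact le_of_mul_le_mul_right (hc'.trans (h6.trans h7)) hKE
  linarith

end Literature.NumberTheory.LFunctions

end
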